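import Mathlib
import HarnessLib
import Literature.Analysis.Approximation.TuranFormEstimates

/-!
# `stub_mnTuranB` — registered stub of line `FilterInvariance`
# (card `band-limited-krylov-dimerisation`), crux `EmbeddedDrudeMourre.GreenKuboContinuation`
# (item stmt-AtomisticToContinuum-12597)

Target `Summits/AtomisticToContinuum/FouriersLaw/Theorems/EmbeddedDrudeMourreGreenKuboContinuationMnTuranB.lean`
(`ledger propose --supports stmt-AtomisticToContinuum-12597`). The theorem name and signature of
`stub_mnTuranB` are REGISTERED and stay verbatim.

## Content (the Turán-determinant limit under bounded variation, with diagonal coefficients)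

Let `A n > 0`, `A n → 1/2`, `Σ |A (n+1) - A n| < ∞`, `B n → 0`, `Σ |B (n+1) - B n| < ∞`, and let
polynomials `p n` satisfy `X p (n+1) = A (n+1) p (n+2) + B (n+1) p (n+1) + A n p n` with `p 0` a
non-zero constant. The Turán quadratic forms
`S_n(x) = p_{n+1}(x)² - ((x - B_{n+1}) / A_n) p_{n+1}(x) p_n(x) + p_n(x)²` converge uniformly on every
`[-1+δ, 1-δ]`, `δ > 0`, to one function `S : ℝ → ℝ` (here `S x := lim_n S_n(x)`), continuous and
strictly positive on `(-1, 1)` (Máté–Nevai 1983; Dombrowski–Nevai 1986, Thm 1). No measure appears.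

## Proof (elementary; the B = 0 analysis lemmas are `Literature.Analysis.Approximation.TuranForm.*`)

On the band `K = [-1+δ, 1-δ]` (`0 < δ ≤ 1`), eventually `A n ≥ a := (4-δ)/8` and `|B (n+1)| ≤ δ/2`,
so `|x - B_{n+1}| / A_n ≤ 2ρ` with `ρ := (1-δ/2)/(2a) < 1` and `S_n ≥ (1-ρ)(p_{n+1}² + p_n²) ≥ 0`
(ellipticity, `TuranForm.quadForm_lower`). Evaluating the recurrence,
`S_{n+1} - S_n = p_{n+2} p_n (A_{n+1} - A_n)(1/A_n + 1/A_{n+1}) + ((B_{n+2} - B_{n+1})/A_{n+1}) p_{n+2} p_{n+1}`,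
whence `|S_{n+1} - S_n| ≤ ε_n (S_{n+1} + S_n)` with
`ε_n = (|A_{n+1} - A_n| + |B_{n+2} - B_{n+1}|) / ((1-ρ) a)` summable. The rest is the `B = 0` argument
verbatim: two-sided discrete Grönwall (`TuranForm.ratio_bounds_of_abs_sub_le`,
`TuranForm.two_sided_gronwall`), a bound for `S_N` on the compact band, uniformly summable increments
(`TuranForm.tendstoUniformlyOn_limUnder_of_dist_succ_le`), continuity on `(-1, 1)`
(`TuranForm.continuousOn_Ioo_of_tendstoUniformlyOn_Icc`), and positivity of `S_N` because two
consecutive `p_n` never vanish together (`p_0 ≠ 0`). The initial relation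
`X p 0 = A 0 p 1 + B 0 p 0` is part of the registered signature but is not used.
-/

noncomputable section

namespace Summit.AtomisticToContinuum.FouriersLaw.Theorems.GreenKuboContinuation.BandLimitedKrylov

open Filter Topology MeasureTheory Set Polynomial
open Literature.Analysis.Approximation

namespace MnTuranB

/-- The one-step identity for the Turán forms along the scalar recurrence with a diagonal term,
`x u₁ = A₁ u₂ + B₁ u₁ + A₀ u₀`: with `T₀ = u₁² - ((x - B₁)/A₀) u₁ u₀ + u₀²` and
`T₁ = u₂² - ((x - B₂)/A₁) u₂ u₁ + u₁²`,
`T₁ - T₀ = u₂ u₀ (A₁ - A₀) (1/A₀ + 1/A₁) + ((B₂ - B₁)/A₁) u₂ u₁`. [folklore] -/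
theorem mnTuranB_step_identity {x u0 u1 u2 A0 A1 B1 B2 T0 T1 : ℝ} (hA0 : A0 ≠ 0) (hA1 : A1 ≠ 0)
    (h : x * u1 = A1 * u2 + B1 * u1 + A0 * u0)
    (hT0 : T0 = u1 ^ 2 - (x - B1) / A0 * u1 * u0 + u0 ^ 2)
    (hT1 : T1 = u2 ^ 2 - (x - B2) / A1 * u2 * u1 + u1 ^ 2) :
    T1 - T0 = u2 * u0 * (A1 - A0) * (1 / A0 + 1 / A1) + (B2 - B1) / A1 * u2 * u1 := by
  have h' : (x - B1) * u1 = A1 * u2 + A0 * u0 := by rw [sub_mul, h]; ring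
  have e0 : (x - B1) / A0 * u1 * u0 = (A1 * u2 + A0 * u0) * u0 / A0 := by
    rw [← h']; ring
  have e1 : (x - B2) / A1 * u2 * u1 = ((A1 * u2 + A0 * u0) - (B2 - B1) * u1) * u2 / A1 := by
    rw [← h']; ring
  rw [hT0, hT1, e0, e1]
  field_simp
  ring

/-- The one-step inequality with a diagonal term: if `0 < a ≤ A₀, A₁`, `ρ ≤ 1`,
`|(x - B₁)/A₀|, |(x - B₂)/A₁| ≤ 2ρ` and `x u₁ = A₁ u₂ + B₁ u₁ + A₀ u₀`, then
`|T₁ - T₀| (1 - ρ) a ≤ (|A₁ - A₀| + |B₂ - B₁|) (T₁ + T₀)`. [folklore] -/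
theorem mnTuranB_step_abs_le {x u0 u1 u2 A0 A1 B1 B2 T0 T1 ρ a : ℝ} (ha : 0 < a) (hA0 : a ≤ A0)
    (hA1 : a ≤ A1) (hρ : ρ ≤ 1) (hx0 : |(x - B1) / A0| ≤ 2 * ρ) (hx1 : |(x - B2) / A1| ≤ 2 * ρ)
    (h : x * u1 = A1 * u2 + B1 * u1 + A0 * u0)
    (hT0 : T0 = u1 ^ 2 - (x - B1) / A0 * u1 * u0 + u0 ^ 2)
    (hT1 : T1 = u2 ^ 2 - (x - B2) / A1 * u2 * u1 + u1 ^ 2) :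
    |T1 - T0| * ((1 - ρ) * a) ≤ (|A1 - A0| + |B2 - B1|) * (T1 + T0) := by
  have hA0p : 0 < A0 := ha.trans_le hA0
  have hA1p : 0 < A1 := ha.trans_le hA1
  have hl0 : (1 - ρ) * (u1 ^ 2 + u0 ^ 2) ≤ T0 := hT0 ▸ TuranForm.quadForm_lower hx0
  have hl1 : (1 - ρ) * (u2 ^ 2 + u1 ^ 2) ≤ T1 := hT1 ▸ TuranForm.quadForm_lower hx1
  have hid := mnTuranB_step_identity hA0p.ne' hA1p.ne' h hT0 hT1
  have hinv : 0 < 1 / A0 + 1 / A1 := by positivity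
  have h1ρ : 0 ≤ 1 - ρ := by linarith
  have hT0nn : 0 ≤ T0 := le_trans (by positivity) hl0
  have hT1nn : 0 ≤ T1 := le_trans (by positivity) hl1
  -- the `A`-variation term
  have b1 : |u2 * u0 * (A1 - A0) * (1 / A0 + 1 / A1)| * ((1 - ρ) * a)
      ≤ |A1 - A0| * (T1 + T0) := by
    rw [abs_mul, abs_mul, abs_of_pos hinv]
    have h2 : 2 * |u2 * u0| ≤ u2 ^ 2 + u0 ^ 2 := by
      rw [abs_mul]
      linarith [two_mul_le_add_sq |u2| |u0|, sq_abs u2, sq_abs u0]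
    have h3 : a * (1 / A0 + 1 / A1) ≤ 2 := by
      rw [mul_add, mul_one_div, mul_one_div]
      have := div_le_one_of_le₀ hA0 hA0p.le
      have := div_le_one_of_le₀ hA1 hA1p.le
      linarith
    have hu1 : 0 ≤ (1 - ρ) * u1 ^ 2 := by positivity
    have h4 : (1 - ρ) * (2 * |u2 * u0|) ≤ T1 + T0 := by
      have := mul_le_mul_of_nonneg_left h2 h1ρ
      nlinarith
    have h5 : 0 ≤ (1 - ρ) * |u2 * u0| * |A1 - A0| := by positivity
    calc |u2 * u0| * |A1 - A0| * (1 / A0 + 1 / A1) * ((1 - ρ) * a)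
          = (1 - ρ) * |u2 * u0| * |A1 - A0| * (a * (1 / A0 + 1 / A1)) := by ring
      _ ≤ (1 - ρ) * |u2 * u0| * |A1 - A0| * 2 := mul_le_mul_of_nonneg_left h3 h5
      _ = (1 - ρ) * (2 * |u2 * u0|) * |A1 - A0| := by ring
      _ ≤ (T1 + T0) * |A1 - A0| := mul_le_mul_of_nonneg_right h4 (abs_nonneg _)
      _ = |A1 - A0| * (T1 + T0) := by ring
  -- the `B`-variation term
  have b2 : |(B2 - B1) / A1 * u2 * u1| * ((1 - ρ) * a) ≤ |B2 - B1| * (T1 + T0) := by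
    rw [abs_mul, abs_mul, abs_div, abs_of_pos hA1p]
    have h2 : 2 * (|u2| * |u1|) ≤ u2 ^ 2 + u1 ^ 2 := by
      linarith [two_mul_le_add_sq |u2| |u1|, sq_abs u2, sq_abs u1]
    have h3 : a / A1 ≤ 1 := div_le_one_of_le₀ hA1 hA1p.le
    have h4 : (1 - ρ) * (2 * (|u2| * |u1|)) ≤ T1 + T0 := by
      have := mul_le_mul_of_nonneg_left h2 h1ρ
      linarith
    have h5 : 0 ≤ |B2 - B1| * (|u2| * |u1|) * (1 - ρ) := by positivity
    calc |B2 - B1| / A1 * |u2| * |u1| * ((1 - ρ) * a)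
          = |B2 - B1| * (|u2| * |u1|) * (1 - ρ) * (a / A1) := by ring
      _ ≤ |B2 - B1| * (|u2| * |u1|) * (1 - ρ) * 1 := mul_le_mul_of_nonneg_left h3 h5
      _ = |B2 - B1| * ((1 - ρ) * (2 * (|u2| * |u1|))) / 2 := by ring
      _ ≤ |B2 - B1| * (T1 + T0) / 2 := by gcongr
      _ ≤ |B2 - B1| * (T1 + T0) := by
          have : 0 ≤ |B2 - B1| * (T1 + T0) := by positivity
          linarith
  rw [hid]
  have h1ρa : 0 ≤ (1 - ρ) * a := by positivity
  calc |u2 * u0 * (A1 - A0) * (1 / A0 + 1 / A1) + (B2 - B1) / A1 * u2 * u1| * ((1 - ρ) * a)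
        ≤ (|u2 * u0 * (A1 - A0) * (1 / A0 + 1 / A1)| + |(B2 - B1) / A1 * u2 * u1|)
          * ((1 - ρ) * a) := mul_le_mul_of_nonneg_right (abs_add_le _ _) h1ρa
    _ = |u2 * u0 * (A1 - A0) * (1 / A0 + 1 / A1)| * ((1 - ρ) * a)
          + |(B2 - B1) / A1 * u2 * u1| * ((1 - ρ) * a) := by ring
    _ ≤ |A1 - A0| * (T1 + T0) + |B2 - B1| * (T1 + T0) := add_le_add b1 b2
    _ = (|A1 - A0| + |B2 - B1|) * (T1 + T0) := by ring

/-- Along the scalar recurrence `x u (n+1) = A (n+1) u (n+2) + B (n+1) u (n+1) + A n u n` with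
`A n ≠ 0` and `u 0 ≠ 0`, two consecutive terms never vanish simultaneously:
`0 < u (m+1)² + u m²`. [folklore] -/
theorem mnTuranB_sq_add_sq_pos (u A B : ℕ → ℝ) (x : ℝ) (hA : ∀ n, A n ≠ 0) (hu0 : u 0 ≠ 0)
    (hrec : ∀ n, x * u (n + 1) = A (n + 1) * u (n + 2) + B (n + 1) * u (n + 1) + A n * u n)
    (m : ℕ) : 0 < u (m + 1) ^ 2 + u m ^ 2 := by
  have key : ∀ m, ¬ (u (m + 1) = 0 ∧ u m = 0) := by
    intro m
    induction m with
    | zero => exact fun h => hu0 h.2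
    | succ m ih =>
      rintro ⟨h2, h1⟩
      apply ih
      refine ⟨h1, ?_⟩
      have := hrec m
      rw [h1, h2, mul_zero, mul_zero, mul_zero, zero_add, zero_add] at this
      exact (mul_eq_zero.1 this.symm).resolve_left (hA m)
  by_cases h1 : u (m + 1) = 0
  · have h0 : u m ≠ 0 := fun h0 => key m ⟨h1, h0⟩
    have := sq_pos_iff.mpr h0
    nlinarith [sq_nonneg (u (m + 1))]
  · have := sq_pos_iff.mpr h1
    nlinarith [sq_nonneg (u m)]

/-- **Core estimate for `stub_mnTuranB` on a band `[-1+δ, 1-δ]`, `0 < δ ≤ 1`.** Along the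
recurrence `x p_{n+1} = A_{n+1} p_{n+2} + B_{n+1} p_{n+1} + A_n p_n` with `A_n > 0`, `A_n → 1/2`,
`Σ|A_{n+1} - A_n| < ∞`, `B_n → 0`, `Σ|B_{n+1} - B_n| < ∞` and `p_0` a non-zero constant, the Turán
forms `F n x = p_{n+1}² - ((x - B_{n+1})/A_n) p_{n+1} p_n + p_n²` have, from some index `N` on and
uniformly on the band, summable increments `|F (n+1) x - F n x| ≤ η n`, a uniform relative lower
bound `c · F N x ≤ F n x` (`c > 0`), and `F N > 0` on the band (ellipticity + one-step identity +
discrete Grönwall; consecutive `p_n` have no common zero).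
(Máté–Nevai 1983; Dombrowski–Nevai 1986, Thm 1.) [folklore] -/
theorem mnTuranB_core (A B : ℕ → ℝ) (p : ℕ → ℝ[X]) (hA : ∀ n, 0 < A n)
    (hAlim : Tendsto A atTop (𝓝 (1 / 2))) (hAbv : Summable (fun n => |A (n + 1) - A n|))
    (hBlim : Tendsto B atTop (𝓝 0)) (hBbv : Summable (fun n => |B (n + 1) - B n|))
    (hp0deg : (p 0).natDegree = 0) (hp0 : p 0 ≠ 0)
    (hrec : ∀ n, X * p (n + 1) =
      C (A (n + 1)) * p (n + 2) + C (B (n + 1)) * p (n + 1) + C (A n) * p n)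
    {δ : ℝ} (hδ : 0 < δ) (hδ1 : δ ≤ 1) (F : ℕ → ℝ → ℝ)
    (hF : ∀ n x, F n x = ((p (n + 1)).eval x) ^ 2
      - (x - B (n + 1)) / A n * (p (n + 1)).eval x * (p n).eval x + ((p n).eval x) ^ 2) :
    ∃ (N : ℕ) (η : ℕ → ℝ) (c : ℝ), Summable η ∧ 0 < c ∧
      (∀ n, N ≤ n → ∀ x ∈ Set.Icc (-1 + δ) (1 - δ), dist (F n x) (F (n + 1) x) ≤ η n) ∧
      (∀ n, N ≤ n → ∀ x ∈ Set.Icc (-1 + δ) (1 - δ), c * F N x ≤ F n x) ∧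
      (∀ x ∈ Set.Icc (-1 + δ) (1 - δ), 0 < F N x) := by
  -- the constants `a` (eventual lower bound of `A`) and `ρ < 1` (ellipticity defect)
  set a : ℝ := (4 - δ) / 8 with ha_def
  have ha0 : 0 < a := by rw [ha_def]; linarith
  have ha2 : a < 1 / 2 := by rw [ha_def]; linarith
  set ρ : ℝ := (1 - δ / 2) / (2 * a) with hρ_def
  have hρ0 : 0 ≤ ρ := div_nonneg (by linarith) (by positivity)
  have hρ1 : ρ < 1 := by
    rw [hρ_def, div_lt_one (by positivity : (0 : ℝ) < 2 * a), ha_def]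
    linarith
  have h2ρa : 2 * ρ * a = 1 - δ / 2 := by
    rw [hρ_def]
    field_simp
  have h1ρ : 0 < 1 - ρ := by linarith
  -- eventual lower bound on `A`, eventual smallness of `B`
  obtain ⟨N₀, hN₀, hN₀B⟩ : ∃ N₀, (∀ n, N₀ ≤ n → a ≤ A n) ∧
      (∀ n, N₀ ≤ n → |B (n + 1)| ≤ δ / 2) := by
    obtain ⟨N₁, hN₁⟩ := eventually_atTop.1 (hAlim.eventually (eventually_ge_nhds ha2))
    obtain ⟨N₂, hN₂⟩ := Metric.tendsto_atTop.1 hBlim (δ / 2) (by positivity)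
    refine ⟨max N₁ N₂, fun n hn => hN₁ n ((le_max_left _ _).trans hn), fun n hn => ?_⟩
    have := hN₂ (n + 1) ((le_max_right _ _).trans (hn.trans (Nat.le_succ n)))
    rw [Real.dist_0_eq_abs] at this
    exact this.le
  -- `|(x - B (n+1)) / A n| ≤ 2ρ` on the band for `n ≥ N₀`
  have hxA : ∀ n, N₀ ≤ n → ∀ x ∈ Set.Icc (-1 + δ) (1 - δ),
      |(x - B (n + 1)) / A n| ≤ 2 * ρ := by
    intro n hn x hx
    rw [abs_div, abs_of_pos (hA n), div_le_iff₀ (hA n)]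
    calc |x - B (n + 1)| ≤ |x| + |B (n + 1)| := abs_sub _ _
      _ ≤ (1 - δ) + δ / 2 := add_le_add (abs_le.2 ⟨by linarith [hx.1], hx.2⟩) (hN₀B n hn)
      _ = 2 * ρ * a := by rw [h2ρa]; ring
      _ ≤ 2 * ρ * A n := mul_le_mul_of_nonneg_left (hN₀ n hn) (by positivity)
  -- the evaluated recurrence, and `p 0` does not vanish
  have hev : ∀ n x, x * (p (n + 1)).eval x
      = A (n + 1) * (p (n + 2)).eval x + B (n + 1) * (p (n + 1)).eval x + A n * (p n).eval x := by
    intro n x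
    have := congrArg (Polynomial.eval x) (hrec n)
    simpa only [eval_mul, eval_X, eval_C, eval_add] using this
  have hu0 : ∀ x, (p 0).eval x ≠ 0 := by
    intro x h0
    rw [eq_C_of_natDegree_eq_zero hp0deg, eval_C] at h0
    apply hp0
    rw [eq_C_of_natDegree_eq_zero hp0deg, h0, C_0]
  -- ellipticity on the band for `n ≥ N₀`
  have hell : ∀ n, N₀ ≤ n → ∀ x ∈ Set.Icc (-1 + δ) (1 - δ),
      (1 - ρ) * (((p (n + 1)).eval x) ^ 2 + ((p n).eval x) ^ 2) ≤ F n x := by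
    intro n hn x hx
    rw [hF]
    exact TuranForm.quadForm_lower (hxA n hn x hx)
  have hFnn : ∀ n, N₀ ≤ n → ∀ x ∈ Set.Icc (-1 + δ) (1 - δ), 0 ≤ F n x := fun n hn x hx =>
    (mul_nonneg h1ρ.le (by positivity)).trans (hell n hn x hx)
  -- the summable sequence `ε n = (|A (n+1) - A n| + |B (n+2) - B (n+1)|) / ((1 - ρ) a)`
  set ε : ℕ → ℝ := fun n => (|A (n + 1) - A n| + |B (n + 2) - B (n + 1)|) / ((1 - ρ) * a)
    with hε_def
  have h1ρa : 0 < (1 - ρ) * a := mul_pos h1ρ ha0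
  have hε0 : ∀ n, 0 ≤ ε n := fun n => div_nonneg (by positivity) h1ρa.le
  have hεs : Summable ε := by
    have hB' : Summable (fun n => |B (n + 2) - B (n + 1)|) := (summable_nat_add_iff 1).2 hBbv
    exact (hAbv.add hB').div_const _
  -- the one-step inequality on the band for `n ≥ N₀`
  have hstep : ∀ n, N₀ ≤ n → ∀ x ∈ Set.Icc (-1 + δ) (1 - δ),
      |F (n + 1) x - F n x| ≤ ε n * (F (n + 1) x + F n x) := by
    intro n hn x hx
    have hn1 : N₀ ≤ n + 1 := Nat.le_succ_of_le hn
    have key := mnTuranB_step_abs_le ha0 (hN₀ n hn) (hN₀ (n + 1) hn1) hρ1.le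
      (hxA n hn x hx) (hxA (n + 1) hn1 x hx) (hev n x) (hF n x) (hF (n + 1) x)
    show |F (n + 1) x - F n x| ≤
      (|A (n + 1) - A n| + |B (n + 2) - B (n + 1)|) / ((1 - ρ) * a) * (F (n + 1) x + F n x)
    rw [div_mul_eq_mul_div, le_div_iff₀ h1ρa]
    exact key
  -- `N₁ ≥ N₀` with `ε n ≤ 1/2` beyond
  obtain ⟨N₁, hN₁0, hN₁⟩ : ∃ N₁, N₀ ≤ N₁ ∧ ∀ n, N₁ ≤ n → ε n ≤ 1 / 2 := by
    have h1 : ∀ᶠ n in atTop, ε n ≤ 1 / 2 :=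
      hεs.tendsto_atTop_zero.eventually (eventually_le_nhds (by norm_num : (0 : ℝ) < 1 / 2))
    obtain ⟨N₁, hN₁⟩ := eventually_atTop.1 (h1.and (eventually_ge_atTop N₀))
    exact ⟨N₁, (hN₁ N₁ le_rfl).2, fun n hn => (hN₁ n hn).1⟩
  -- two-sided Grönwall control from level `N₁` on
  set E : ℝ := ∑' k, 4 * ε k with hE_def
  have hG : ∀ x ∈ Set.Icc (-1 + δ) (1 - δ), ∀ n, N₁ ≤ n →
      F n x ≤ Real.exp E * F N₁ x ∧ F N₁ x ≤ Real.exp E * F n x := by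
    intro x hx
    refine TuranForm.two_sided_gronwall (fun n => F n x) (fun n => 4 * ε n) N₁
      (fun n => mul_nonneg (by norm_num) (hε0 n)) (hεs.mul_left 4)
      (fun n hn => hFnn n (hN₁0.trans hn) x hx) ?_ ?_
    · intro n hn
      have hn0 : N₀ ≤ n := hN₁0.trans hn
      exact (TuranForm.ratio_bounds_of_abs_sub_le (hFnn n hn0 x hx)
        (hFnn (n + 1) (Nat.le_succ_of_le hn0) x hx) (hε0 n) (hN₁ n hn) (hstep n hn0 x hx)).1
    · intro n hn
      have hn0 : N₀ ≤ n := hN₁0.trans hn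
      exact (TuranForm.ratio_bounds_of_abs_sub_le (hFnn n hn0 x hx)
        (hFnn (n + 1) (Nat.le_succ_of_le hn0) x hx) (hε0 n) (hN₁ n hn) (hstep n hn0 x hx)).2
  -- a bound for `F N₁` on the (compact) band
  have hcont : Continuous (F N₁) := by
    rw [funext (hF N₁)]
    fun_prop
  obtain ⟨M, hM⟩ := isCompact_Icc.exists_bound_of_continuousOn hcont.continuousOn
  have hM' : ∀ x ∈ Set.Icc (-1 + δ) (1 - δ), F N₁ x ≤ max M 0 := by
    intro x hx
    have := hM x hx
    rw [Real.norm_eq_abs] at this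
    exact ((le_abs_self _).trans this).trans (le_max_left _ _)
  have hB : ∀ x ∈ Set.Icc (-1 + δ) (1 - δ), ∀ n, N₁ ≤ n → F n x ≤ Real.exp E * max M 0 :=
    fun x hx n hn => (hG x hx n hn).1.trans
      (mul_le_mul_of_nonneg_left (hM' x hx) (Real.exp_pos _).le)
  refine ⟨N₁, fun n => ε n * (2 * (Real.exp E * max M 0)), Real.exp (-E), hεs.mul_right _,
    Real.exp_pos _, ?_, ?_, ?_⟩
  · intro n hn x hx
    rw [Real.dist_eq, abs_sub_comm]
    refine (hstep n (hN₁0.trans hn) x hx).trans (mul_le_mul_of_nonneg_left ?_ (hε0 n))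
    have b1 := hB x hx (n + 1) (Nat.le_succ_of_le hn)
    have b0 := hB x hx n hn
    linarith
  · intro n hn x hx
    rw [Real.exp_neg, inv_mul_le_iff₀ (Real.exp_pos _)]
    exact (hG x hx n hn).2
  · intro x hx
    have hsq := mnTuranB_sq_add_sq_pos (fun k => (p k).eval x) A B x
      (fun n => (hA n).ne') (hu0 x) (fun n => hev n x) N₁
    exact lt_of_lt_of_le (mul_pos h1ρ hsq) (hell N₁ hN₁0 x hx)

end MnTuranB

open MnTuranB in
/-- **`stub_mnTuranB` — the Turán-determinant limit under bounded variation, with diagonal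
coefficients** (Máté–Nevai 1983; Dombrowski–Nevai 1986, Thm 1, in the quadratic-form
normalisation). Let `A_n > 0`, `A_n → 1/2`, `Σ|A_{n+1} - A_n| < ∞`, `B_n → 0`, `Σ|B_{n+1} - B_n| < ∞`,
and let the polynomials `p_n` satisfy `x p_0 = A_0 p_1 + B_0 p_0`,
`x p_{n+1} = A_{n+1} p_{n+2} + B_{n+1} p_{n+1} + A_n p_n` with `p_0` a non-zero constant. Then the
Turán forms `S_n(x) = p_{n+1}(x)² - ((x - B_{n+1}) / A_n) p_{n+1}(x) p_n(x) + p_n(x)²` converge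
uniformly on every `[-1+δ, 1-δ]` (`δ > 0`) to one function `S`, continuous and strictly positive on
`(-1, 1)`. Proof: ellipticity `S_n ≥ (1 - ρ)(p_{n+1}² + p_n²)` on the band, the one-step identity
`S_{n+1} - S_n = p_{n+2} p_n (A_{n+1} - A_n)(1/A_n + 1/A_{n+1}) + ((B_{n+2} - B_{n+1})/A_{n+1}) p_{n+2} p_{n+1}`,
hence `|S_{n+1} - S_n| ≤ ε_n (S_{n+1} + S_n)` with `Σ ε_n < ∞`; a two-sided discrete Grönwall lemma
gives uniform bounds, hence uniformly summable increments; consecutive `p_n` have no common zero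
since `p_0 ≠ 0`. (The initial relation `x p_0 = A_0 p_1 + B_0 p_0` is not needed.)
[cite: DombrowskiNevai1986, Thm 1] -/
theorem stub_mnTuranB :
    ∀ (A B : ℕ → ℝ) (p : ℕ → ℝ[X]),
      (∀ n, 0 < A n) → Tendsto A atTop (𝓝 (1 / 2)) → Summable (fun n => |A (n + 1) - A n|) →
      Tendsto B atTop (𝓝 0) → Summable (fun n => |B (n + 1) - B n|) →
      (p 0).natDegree = 0 → p 0 ≠ 0 →
      X * p 0 = C (A 0) * p 1 + C (B 0) * p 0 →
      (∀ n, X * p (n + 1) = C (A (n + 1)) * p (n + 2) + C (B (n + 1)) * p (n + 1) + C (A n) * p n) →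
      ∃ S : ℝ → ℝ, ContinuousOn S (Set.Ioo (-1) 1) ∧ (∀ x ∈ Set.Ioo (-1 : ℝ) 1, 0 < S x) ∧
        ∀ δ : ℝ, 0 < δ →
          TendstoUniformlyOn
            (fun (n : ℕ) (x : ℝ) => ((p (n + 1)).eval x) ^ 2
              - (x - B (n + 1)) / A n * (p (n + 1)).eval x * (p n).eval x + ((p n).eval x) ^ 2)
            S atTop (Set.Icc (-1 + δ) (1 - δ)) := by
  intro A B p hA hAlim hAbv hBlim hBbv hp0deg hp0 _hrec0 hrec
  set F : ℕ → ℝ → ℝ := fun n x => ((p (n + 1)).eval x) ^ 2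
      - (x - B (n + 1)) / A n * (p (n + 1)).eval x * (p n).eval x + ((p n).eval x) ^ 2 with hF_def
  have hF : ∀ n x, F n x = ((p (n + 1)).eval x) ^ 2
      - (x - B (n + 1)) / A n * (p (n + 1)).eval x * (p n).eval x + ((p n).eval x) ^ 2 :=
    fun n x => rfl
  set S : ℝ → ℝ := fun x => limUnder atTop (fun n => F n x) with hS_def
  -- uniform convergence on every band
  have hunif1 : ∀ δ : ℝ, 0 < δ → δ ≤ 1 →
      TendstoUniformlyOn F S atTop (Set.Icc (-1 + δ) (1 - δ)) := by
    intro δ hδ hδ1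
    obtain ⟨N, η, c, hη, -, hinc, -, -⟩ :=
      mnTuranB_core A B p hA hAlim hAbv hBlim hBbv hp0deg hp0 hrec hδ hδ1 F hF
    exact TuranForm.tendstoUniformlyOn_limUnder_of_dist_succ_le F _ η N hη hinc
  have hunif : ∀ δ : ℝ, 0 < δ → TendstoUniformlyOn F S atTop (Set.Icc (-1 + δ) (1 - δ)) := by
    intro δ hδ
    refine (hunif1 (min δ 1) (lt_min hδ one_pos) (min_le_right _ _)).mono ?_
    exact Set.Icc_subset_Icc (by linarith [min_le_left δ 1]) (by linarith [min_le_left δ 1])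
  have hFcont : ∀ n, Continuous (F n) := fun n => by
    rw [funext (hF n)]
    fun_prop
  refine ⟨S, TuranForm.continuousOn_Ioo_of_tendstoUniformlyOn_Icc F S hFcont hunif, ?_, hunif⟩
  -- strict positivity on `(-1, 1)`
  intro x hx
  set δ : ℝ := min (x + 1) (1 - x) / 2 with hδ_def
  have hx1 : 0 < x + 1 := by linarith [hx.1]
  have hx2 : 0 < 1 - x := by linarith [hx.2]
  have hδ : 0 < δ := by positivity
  have hδ1 : δ ≤ 1 := by
    have := min_le_left (x + 1) (1 - x)
    have := min_le_right (x + 1) (1 - x)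
    rw [hδ_def]
    linarith
  have hxK : x ∈ Set.Icc (-1 + δ) (1 - δ) := by
    have := min_le_left (x + 1) (1 - x)
    have := min_le_right (x + 1) (1 - x)
    constructor <;> linarith
  obtain ⟨N, η, c, -, hc, -, hlow, hpos⟩ :=
    mnTuranB_core A B p hA hAlim hAbv hBlim hBbv hp0deg hp0 hrec hδ hδ1 F hF
  have hlim : Tendsto (fun n => F n x) atTop (𝓝 (S x)) := (hunif δ hδ).tendsto_at hxK
  have hevn : ∀ᶠ n in atTop, c * F N x ≤ F n x :=
    eventually_atTop.2 ⟨N, fun n hn => hlow n hn x hxK⟩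
  exact lt_of_lt_of_le (mul_pos hc (hpos x hxK)) (ge_of_tendsto hlim hevn)

end Summit.AtomisticToContinuum.FouriersLaw.Theorems.GreenKuboContinuation.BandLimitedKrylov

end
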